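import Literature.AnabelianGeometry.EtaleTheta.FrobenioidThetaBiKummer

/-!
# [EtTh] §5: Theorem 5.7 at the level of the `N`-th root — the transport of `(s^⊓_N, s^⊔_N)` under `Ψ` (pp. 329–330 / PDF pp. 103–104)

Mochizuki, *The étale theta function …*, Publ. RIMS **45** (2009)
[cite: MochizukiEtTh2009, Thm 5.7 p.329–330 (PDF pp.103–104)].  Seat abc-iut-L2-t4 (R-9 re-typing ordered
by abc-iut-L2-lead 20:15:02Z; shape proposed by abc-iut-L2-d4 20:46:16Z and adopted verbatim).

**Theorem 5.7** says that the self-equivalence `Ψ : C ⥲ C` "preserves right fraction-pairs of [the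
Frobenioid-theoretic version of the log-meromorphic function constituted by] an `l`-th root of the theta
function `Θ̈(√−1)⁻¹ · Θ̈` … [normalized so as to be 'of standard type'], up to possible multiplication by a
`2l`-th root of unity and possible translation by an element of … `l·ℤ`".  `FrobenioidCyclotomicRigidity.
ThetaFunctionPreserved` types this over the vocabulary stub `StdThetaPairStub` (the class of such
fraction-pairs is abc-iut-L2-t3/t2/t1 vocabulary) and is therefore quantified over a stub; THIS file gives
the CONTENT-BEARING form over the §5 data proper, at the level at which Theorem 5.10 (ii) consumes it
(proof of Thm. 5.10 (ii), pp.334–335 (PDF pp.108–109): "`Ψ` preserves `N`-th roots of fraction pairs …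
together with the corresponding bi-Kummer `N`-th roots … for … `l`-th roots of the theta function [i.e., up
to the indeterminacies discussed in the statement of Theorem 5.7]"): composing Theorem 5.7 with the
"isomorphism between the two given `N`-th roots of fraction-pairs" of Proposition 4.2 (iv) (p.315 (PDF
p.89)) and the chosen isomorphisms `α : Ψ(A_N) ⥲ A_N`, `β : Ψ(B_N) ⥲ B_N` of Theorem 5.10 (i)/(ii), the
`Ψ`-image of the root `(s^⊓_N, s^⊔_N)` is isomorphic to the root itself up to a constant
`δ₂ ∈ μ_{2l·N}(B_N) ∩ (O_K^×)^{1/N}` (the "`2l`-th root of unity", at level `N`) and a translate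
`δ₃ ∈ s^⊓-gp_N(Aut_D(B_N^bs))` (the "translation by an element of `l·ℤ ≅ Π^tp_X̲/Π^tp_Y̲`", Lemma 5.9 (iii))
— exactly the `δ₂, δ₃` of Theorem 5.10 (ii), p.334 (PDF p.108).  HONEST FRAMING: a `Prop`-valued
predicate on `(Ψ, α, β)`; nothing of [EtTh] is asserted; no side is taken on any disputed claim.
-/

namespace Literature.AnabelianGeometry.EtaleTheta

open CategoryTheory

universe w v v' u u'

namespace ThetaFrobenioid

variable {C : Type u} [Category.{v} C] {D : Type u'} [Category.{v'} D] (𝔉 : ThetaFrobenioid.{w} C D)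

/-- **[EtTh] Theorem 5.7 at the `N`-th root** (with Prop. 4.2 (iv)): for the self-equivalence `Ψ` and
isomorphisms `α : Ψ(A_N) ⥲ A_N`, `β : Ψ(B_N) ⥲ B_N` [Thm. 5.10 (i)], the transported pair
`(α⁻¹ ≫ Ψ(s^⊓_N) ≫ β, α⁻¹ ≫ Ψ(s^⊔_N) ≫ β)` agrees with `(s^⊓_N, s^⊔_N)` up to an automorphism `e` of `A_N`
[the `ζ_A` of Prop. 4.2 (iv)] and automorphisms `D_c, D_p` of `B_N` whose discrepancy `D_c⁻¹ · D_p` is a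
constant `δ₂ ∈ μ_{2l·N}(B_N) ∩ (O_K^×)^{1/N}` ("up to possible multiplication by a `2l`-th root of unity",
Thm. 5.7) times a translate `δ₃ ∈ Im(s^⊓-gp_N)` ("possible translation by an element of … `l·ℤ`",
Thm. 5.7; Lemma 5.9 (iii)).  Shape: abc-iut-L2-d4; consumed by its `Sec5Thm510ii`.
[cite: MochizukiEtTh2009, Thm 5.7 p.329–330 (PDF pp.103–104); Prop 4.2 (iv) p.315 (PDF p.89)] -/
def RootTransport (Ψ : C ≌ C) (α : Ψ.functor.obj 𝔉.AN ≅ 𝔉.AN) (β : Ψ.functor.obj 𝔉.BN ≅ 𝔉.BN) :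
    Prop :=
  ∃ (e : 𝔉.AN ≅ 𝔉.AN) (Dc Dp : Aut 𝔉.BN),
    α.inv ≫ Ψ.functor.map 𝔉.sCap ≫ β.hom = e.hom ≫ 𝔉.sCap ≫ Dc.hom ∧
    α.inv ≫ Ψ.functor.map 𝔉.sCup ≫ β.hom = e.hom ≫ 𝔉.sCup ≫ Dp.hom ∧
    ∃ δ₂ ∈ 𝔉.muTorsion 𝔉.BN (2 * 𝔉.l * 𝔉.N) ⊓ 𝔉.OKxRootN, ∃ δ₃ ∈ 𝔉.sgpCap.range,
      Dc⁻¹ * Dp = δ₂ * δ₃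

/-- **[EtTh] Theorem 5.7 (Category-theoreticity of the Frobenioid-theoretic Theta Function), root-level
form for all choices**: every self-equivalence `Ψ` that preserves the isomorphism classes of `A_N`, `B_N`
[Thm. 5.10 (i)] transports the root `(s^⊓_N, s^⊔_N)` to itself up to the printed indeterminacies, for
every choice of `α, β`.  [cite: MochizukiEtTh2009, Thm 5.7 p.329–330 (PDF pp.103–104)] -/
def ThetaRootPreserved (Ψ : C ≌ C) : Prop :=
  ∀ (α : Ψ.functor.obj 𝔉.AN ≅ 𝔉.AN) (β : Ψ.functor.obj 𝔉.BN ≅ 𝔉.BN), 𝔉.RootTransport Ψ α β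

/-- If the root is transported for ONE choice of `(α, β)`, changing `α` by an automorphism of `A_N` is
absorbed into `e` (the `ζ_A`-freedom of Prop. 4.2 (iv)).  PROVED.
[cite: MochizukiEtTh2009, Prop 4.2 (iv) p.315 (PDF p.89)] -/
theorem rootTransport_of_comp_left {Ψ : C ≌ C} {α : Ψ.functor.obj 𝔉.AN ≅ 𝔉.AN}
    {β : Ψ.functor.obj 𝔉.BN ≅ 𝔉.BN} (h : 𝔉.RootTransport Ψ α β) (a : 𝔉.AN ≅ 𝔉.AN) :
    𝔉.RootTransport Ψ (α ≪≫ a) β := by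
  obtain ⟨e, Dc, Dp, h1, h2, rest⟩ := h
  refine ⟨a.symm ≪≫ e, Dc, Dp, ?_, ?_, rest⟩
  · rw [Iso.trans_inv, Category.assoc, h1]
    simp
  · rw [Iso.trans_inv, Category.assoc, h2]
    simp

/-! ### The same predicate with its witnesses exposed (the shape Theorem 5.10 (ii) consumes)

Appended (v2; append-only, the three declarations above are byte-identical to v1 p410172) at the request
of the consumer abc-iut-L2-d4 (22:42:10Z): `Discharge/Sec5Thm510ii.psiAutPreserves_of` takes the three
conjuncts of `RootTransport` for GIVEN witnesses `(e, D_c, D_p)` together with — for the SAME `e` — the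
transport of the base-Frobenius section `s^trv_N` (print uses ONE identification `Ψ(A_N) ⥲ A_N` for
Theorem 5.7 and Theorem 4.4 (iv) alike, pp.334–335 (PDF pp.108–109)), so the existentially closed
`RootTransport` cannot be cited there by name; `RootTransportWith` can. -/

/-- **[EtTh] Theorem 5.7 at the `N`-th root, witnesses exposed**: for the self-equivalence `Ψ`, isomorphisms
`α : Ψ(A_N) ⥲ A_N`, `β : Ψ(B_N) ⥲ B_N` [Thm. 5.10 (i)] and GIVEN `e ∈ Aut_C(A_N)` [the `ζ_A` of Prop. 4.2 (iv)],
`D_c, D_p ∈ Aut_C(B_N)`: the transported pair `(α⁻¹ ≫ Ψ(s^⊓_N) ≫ β, α⁻¹ ≫ Ψ(s^⊔_N) ≫ β)` equals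
`(e ≫ s^⊓_N ≫ D_c, e ≫ s^⊔_N ≫ D_p)` and the discrepancy `D_c⁻¹ · D_p` is a constant
`δ₂ ∈ μ_{2l·N}(B_N) ∩ (O_K^×)^{1/N}` ("up to possible multiplication by a `2l`-th root of unity", Thm. 5.7,
p.329–330 (PDF pp.103–104)) times a translate `δ₃ ∈ Im(s^⊓-gp_N)` ("possible translation by an element of … `l·ℤ`",
Thm. 5.7; Lemma 5.9 (iii)) — i.e. the three conjuncts of `RootTransport Ψ α β` for these witnesses
(`rootTransport_iff`).  [cite: MochizukiEtTh2009, Thm 5.7 p.329–330 (PDF pp.103–104); Prop 4.2 (iv) p.315 (PDF p.89)] -/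
def RootTransportWith (Ψ : C ≌ C) (α : Ψ.functor.obj 𝔉.AN ≅ 𝔉.AN) (β : Ψ.functor.obj 𝔉.BN ≅ 𝔉.BN)
    (e : 𝔉.AN ≅ 𝔉.AN) (Dc Dp : Aut 𝔉.BN) : Prop :=
  α.inv ≫ Ψ.functor.map 𝔉.sCap ≫ β.hom = e.hom ≫ 𝔉.sCap ≫ Dc.hom ∧
    α.inv ≫ Ψ.functor.map 𝔉.sCup ≫ β.hom = e.hom ≫ 𝔉.sCup ≫ Dp.hom ∧
    ∃ δ₂ ∈ 𝔉.muTorsion 𝔉.BN (2 * 𝔉.l * 𝔉.N) ⊓ 𝔉.OKxRootN, ∃ δ₃ ∈ 𝔉.sgpCap.range,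
      Dc⁻¹ * Dp = δ₂ * δ₃

/-- `RootTransport Ψ α β` is, by definition, `RootTransportWith Ψ α β e D_c D_p` for SOME witnesses.
[cite: MochizukiEtTh2009, Thm 5.7 p.329–330 (PDF pp.103–104)] -/
theorem rootTransport_iff {Ψ : C ≌ C} {α : Ψ.functor.obj 𝔉.AN ≅ 𝔉.AN} {β : Ψ.functor.obj 𝔉.BN ≅ 𝔉.BN} :
    𝔉.RootTransport Ψ α β ↔ ∃ (e : 𝔉.AN ≅ 𝔉.AN) (Dc Dp : Aut 𝔉.BN), 𝔉.RootTransportWith Ψ α β e Dc Dp :=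
  Iff.rfl

/-- Forgetting the witnesses.  [cite: MochizukiEtTh2009, Thm 5.7 p.329–330 (PDF pp.103–104)] -/
theorem RootTransportWith.rootTransport {Ψ : C ≌ C} {α : Ψ.functor.obj 𝔉.AN ≅ 𝔉.AN}
    {β : Ψ.functor.obj 𝔉.BN ≅ 𝔉.BN} {e : 𝔉.AN ≅ 𝔉.AN} {Dc Dp : Aut 𝔉.BN}
    (h : 𝔉.RootTransportWith Ψ α β e Dc Dp) : 𝔉.RootTransport Ψ α β :=
  ⟨e, Dc, Dp, h⟩

/-- **WLOG `e = 1`**: replacing `α` by `α ≪≫ e` absorbs the `ζ_A`-freedom of Prop. 4.2 (iv) (p.315 (PDF p.89)), so the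
root is transported with witness `e = id_{A_N}` and the SAME `D_c, D_p`.  PROVED.
[cite: MochizukiEtTh2009, Prop 4.2 (iv) p.315 (PDF p.89)] -/
theorem RootTransportWith.trans_left {Ψ : C ≌ C} {α : Ψ.functor.obj 𝔉.AN ≅ 𝔉.AN}
    {β : Ψ.functor.obj 𝔉.BN ≅ 𝔉.BN} {e : 𝔉.AN ≅ 𝔉.AN} {Dc Dp : Aut 𝔉.BN}
    (h : 𝔉.RootTransportWith Ψ α β e Dc Dp) :
    𝔉.RootTransportWith Ψ (α ≪≫ e) β (Iso.refl 𝔉.AN) Dc Dp := by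
  obtain ⟨h1, h2, rest⟩ := h
  refine ⟨?_, ?_, rest⟩
  · rw [Iso.trans_inv, Category.assoc, h1, Iso.refl_hom, Category.id_comp, Iso.inv_hom_id_assoc]
  · rw [Iso.trans_inv, Category.assoc, h2, Iso.refl_hom, Category.id_comp, Iso.inv_hom_id_assoc]

/-- Hence: if the root is transported at all for `(Ψ, β)` and some `α`, then for a suitable `α'` it is transported
with witness `e = id_{A_N}` (the normalisation under which Theorem 5.10 (ii)'s transport of `s^trv_N` is stated
relative to `α'` alone).  [cite: MochizukiEtTh2009, Prop 4.2 (iv) p.315 (PDF p.89); Thm 5.10 (ii) p.334 (PDF p.108)] -/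
theorem exists_rootTransportWith_refl {Ψ : C ≌ C} {α : Ψ.functor.obj 𝔉.AN ≅ 𝔉.AN}
    {β : Ψ.functor.obj 𝔉.BN ≅ 𝔉.BN} (h : 𝔉.RootTransport Ψ α β) :
    ∃ (α' : Ψ.functor.obj 𝔉.AN ≅ 𝔉.AN) (Dc Dp : Aut 𝔉.BN),
      𝔉.RootTransportWith Ψ α' β (Iso.refl 𝔉.AN) Dc Dp := by
  obtain ⟨e, Dc, Dp, h⟩ := h
  exact ⟨α ≪≫ e, Dc, Dp, RootTransportWith.trans_left 𝔉 h⟩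

/-! ### Theorem 4.4 (iv) at the `N`-th root: the transport of the base-Frobenius section `s^trv_N` (v3, append-only)

Appended at the request of the consumer abc-iut-L2-d4 (2026-08-25T23:50:34Z): the hypothesis `hstrv` of
`Discharge/Sec5Thm510ii.psiAutPreserves_of` / `Discharge/Sec5Thm510OfRootTransport` — "`Ψ` preserves … the
corresponding bi-Kummer `N`-th roots [cf. Theorem 4.4, (iv)]" (proof of Thm. 5.10 (ii), p.334–335 (PDF
pp.108–109)), i.e. the transport under `Ψ` of "the group homomorphism `s^trv_N : Aut_D(A_N^bs) → Aut_C(A_N)` …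
arising from a base-Frobenius pair of `A_N` … completely determined … up to conjugation by an element of
`O^×(A_N)`" (pp.330–331 (PDF pp.104–105)) — as ONE named predicate, so that Theorem 4.4 (iv) is cited by name too. -/

/-- **[EtTh] Theorem 4.4 (iv) at the `N`-th root (transport of `s^trv_N`)**: for the self-equivalence `Ψ`, the
isomorphism `α : Ψ(A_N) ⥲ A_N`, the `ζ_A`-witness `e ∈ Aut_C(A_N)` of `RootTransportWith` and an automorphism `θ`
of `Aut_D(B_N^bs)` (the one induced by `Ψ^bs`, Thm. 4.4 (i); read on `Aut_D(A_N^bs)` through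
`Aut_D(A_N^bs) ⥲ Aut_D(B_N^bs)`): conjugating `Ψ(s^trv_N(g))` back along `α` and `e` gives `s^trv_N(θ g)` — "`Ψ`
preserves … the corresponding bi-Kummer `N`-th roots [cf. Theorem 4.4, (iv)]" (p.334–335 (PDF pp.108–109)),
the bi-Kummer root being determined by `s^trv_N` (Prop. 4.3 (i), p.316 (PDF p.90); p.331 (PDF p.105)).  This is
EXACTLY the binder `hstrv` of abc-iut-L2-d4's `psiAutPreserves_of`.
[cite: MochizukiEtTh2009, Thm 4.4 (iv) p.320 (PDF p.94); Thm 5.10 (ii) p.334–335 (PDF pp.108–109)] -/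
def StrvTransport (Ψ : C ≌ C) (α : Ψ.functor.obj 𝔉.AN ≅ 𝔉.AN) (e : 𝔉.AN ≅ 𝔉.AN)
    (θ : Aut (𝔉.base.obj 𝔉.BN) ≃* Aut (𝔉.base.obj 𝔉.BN)) : Prop :=
  ∀ g : Aut (𝔉.base.obj 𝔉.BN),
    α.inv ≫ Ψ.functor.map (𝔉.strv (𝔉.autBaseIsoAB.symm g)).hom ≫ α.hom ≫ e.hom =
      e.hom ≫ (𝔉.strv (𝔉.autBaseIsoAB.symm (θ g))).hom

/-- `StrvTransport` unfolds to the binder shape of `Discharge/Sec5Thm510ii.psiAutPreserves_of` (definitionally).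
[cite: MochizukiEtTh2009, Thm 5.10 (ii) p.334 (PDF p.108)] -/
theorem strvTransport_iff {Ψ : C ≌ C} {α : Ψ.functor.obj 𝔉.AN ≅ 𝔉.AN} {e : 𝔉.AN ≅ 𝔉.AN}
    {θ : Aut (𝔉.base.obj 𝔉.BN) ≃* Aut (𝔉.base.obj 𝔉.BN)} :
    𝔉.StrvTransport Ψ α e θ ↔ ∀ g : Aut (𝔉.base.obj 𝔉.BN),
      α.inv ≫ Ψ.functor.map (𝔉.strv (𝔉.autBaseIsoAB.symm g)).hom ≫ α.hom ≫ e.hom =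
        e.hom ≫ (𝔉.strv (𝔉.autBaseIsoAB.symm (θ g))).hom :=
  Iff.rfl

/-- **WLOG `e = 1`** for the `s^trv`-transport as well: replacing `α` by `α ≪≫ e` (as in
`RootTransportWith.trans_left`) turns the witness into the identity, for the SAME `θ`.
[cite: MochizukiEtTh2009, Prop 4.2 (iv) p.315 (PDF p.89); Thm 5.10 (ii) p.334 (PDF p.108)] -/
theorem StrvTransport.trans_left {Ψ : C ≌ C} {α : Ψ.functor.obj 𝔉.AN ≅ 𝔉.AN} {e : 𝔉.AN ≅ 𝔉.AN}
    {θ : Aut (𝔉.base.obj 𝔉.BN) ≃* Aut (𝔉.base.obj 𝔉.BN)} (h : 𝔉.StrvTransport Ψ α e θ) :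
    𝔉.StrvTransport Ψ (α ≪≫ e) (Iso.refl 𝔉.AN) θ := by
  intro g
  have hg := h g
  rw [Iso.trans_inv, Iso.trans_hom, Iso.refl_hom, Category.comp_id, Category.id_comp, Category.assoc]
  rw [← cancel_epi e.hom, ← Category.assoc e.hom e.inv, e.hom_inv_id, Category.id_comp]
  simpa [Category.assoc] using hg

end ThetaFrobenioid

end Literature.AnabelianGeometry.EtaleTheta
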